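import Literature.AlgebraicTopology.SingularHomology.RelativeHomology
import Literature.AlgebraicTopology.SingularHomology.ExcisionMayerVietoris
import Literature.AlgebraicTopology.SingularHomology.UniversalCoefficientsField
import HarnessLib

/-!
# Propagation of the support of a cohomology class from one fibre to the total space: a homological criterion

Pure topology, a brick for the structure theorems on algebraicity loci
(`Literature/AlgebraicGeometry/HodgeTheory/AlgebraicityLocus`: C. Voisin, *Hodge loci and
absolute Hodge classes*, Compositio 143 (2007), §0; F. Charles, C. Schnell, *Notes on absolute
Hodge classes* (2014), proof of Prop. 11.3.11; C. Voisin, *Hodge Theory II* (2003), §3.3.1 and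
§7.3.2). There the algebraic classes of a fibre are SUPPORT-defined (a class is algebraic when it
dies on the complement of a Zariski-closed subset of the right codimension), the good sets
"`A|_{𝒳_y}` dies off the member `V_y` of a family of supports" are CLOSED in the strong topology
(`HodgeTheory/SupportedLocusClosed`, upper semicontinuity of supports), and what the printed proof
obtains from the flatness of cycle classes ("the condition is open") must, on these carriers, be
an OPENNESS statement for supports: if `A` dies on `X₀ ∖ V₀` in the central fibre `X₀` of a family
`E → D` over a small ball, then `A` dies on `E ∖ V` (hence on `X_y ∖ V_y` for every `y ∈ D`).
Supports are only upper semicontinuous in general (a conic degenerating to a line pair: the class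
of one line dies off the line pair but not off the nearby smooth conics), so such a statement
needs hypotheses; this file isolates HOMOLOGICAL ones and proves the propagation from them, by a
diagram chase on the long exact sequences of the pairs (Hatcher, *Algebraic Topology*, §2.1) and
universal coefficients over a field (Hatcher, §3.1 Thm. 3.2):

* `map_subsetIncl_compl_eq_zero_of_surjective_of_injective` — **the propagation lemma.** Let
  `j : P → U` be continuous (in the application: the inclusion of the central fibre, both
  deprived of a thin bad set), `S ⊆ U` (the support in the total space; `j⁻¹S` is the support in
  the fibre), `Ψ ∈ Hᵏ(U; F)` over a field `F`. Suppose
  (S1) `j_* : Hₖ(P) → Hₖ(U)` is ONTO (the fibre carries the `k`-cycles of the total space), and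
  (S2) `j_* : Hₖ(P, P ∖ j⁻¹S) → Hₖ(U, U ∖ S)` is ONE-TO-ONE (the local homology at the support
  in the fibre — in the application a line spanned by a transverse disc class, the topological
  Thom class of `HodgeTheory/SupportedClassesPurity` — survives in the total space).
  If `Ψ` pulled back to `P ∖ j⁻¹S` vanishes, then `Ψ|_{U ∖ S} = 0`.
  Proof: pair `Ψ|_{U ∖ S}` with `b ∈ Hₖ(U ∖ S)`; its image `β ∈ Hₖ(U)` is `j_* a₀` by (S1) and
  dies in `Hₖ(U, U ∖ S)`, so `a₀` dies in `Hₖ(P, P ∖ j⁻¹S)` by naturality and (S2), hence comes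
  from `a₁ ∈ Hₖ(P ∖ j⁻¹S)` (exactness), and `⟨Ψ, β⟩ = ⟨Ψ|_{P ∖ j⁻¹S}, a₁⟩ = 0`.
* `map_subsetIncl_compl_eq_zero_of_fibre` — the same for a map `ι₀ : X₀ → E` and subsets
  `Z ⊆ V ⊆ E` (the bad set inside the support), with `U = E ∖ Z`, `P = X₀ ∖ ι₀⁻¹Z`, `S = V ∖ Z`:
  if `Ψ ∈ Hᵏ(E; F)` dies on `X₀ ∖ ι₀⁻¹V` then it dies on `E ∖ V`.
* `mem_iSup_ker_of_fibre` — **sums of supports.** If moreover `ι₀^* : Hᵏ(E) → Hᵏ(X₀)` is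
  bijective (in the application: Ehresmann's trivialisation over a ball) and (S1), (S2) hold for
  each member of a family `Z i ⊆ V i`, then a class `A ∈ Hᵏ(E; F)` whose restriction to `X₀` is
  a SUM of classes dying on the `X₀ ∖ ι₀⁻¹(V i)` is itself a sum of classes dying on the
  `E ∖ V i`; `map_mem_iSup_ker_of_fibre` — hence its pull-back along any `g : T → E` (another
  fibre) is a sum of classes dying on the `T ∖ g⁻¹(V i)`.

The hypotheses are discharged, for smooth projective families and the smooth part of a flat
family of subvarieties near a point where it is equisingular, by the semipurity of the coniveau
filtration in the fibre and in the total space (`HodgeTheory/SupportedClassesSemipurity`,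
`SingularHomology/LocallyFlatComplement`) for (S1), and by the Thom line of the smooth part
(`SingularHomology/LocallyFlatCriticalDegree`) with a transverse disc functional
(`SingularHomology/TransverseDiscFunctional`) for (S2); none of that is done here.
Everything here is proved; no definitions, no named facts.

## References

* [HatcherAT2002] A. Hatcher, Algebraic Topology, CUP 2002, §2.1 (long exact sequence of the
  pair, naturality), §3.1 Thm. 3.2 (universal coefficients over a field).
* [Voisin2007HodgeLoci] C. Voisin, Hodge loci and absolute Hodge classes, Compositio Math. 143
  (2007), §0.
* [CharlesSchnell2014Notes] F. Charles, C. Schnell, Notes on absolute Hodge classes, in Hodge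
  Theory (Princeton Math. Notes 49, 2014), Prop. 11.3.11 (proof).
-/

noncomputable section

open CategoryTheory Set

universe u v w

namespace Literature.AlgebraicTopology.SingularHomology

variable (F : Type v) [Field F]

/-! ### The propagation lemma -/

/-- **Propagation of the support of a class from a fibre, homological criterion.** Let
`j : P → U` be continuous, `S ⊆ U`, and `Ψ ∈ Hᵏ(U; F)` (`F` a field). If
(S1) `j_* : Hₖ(P; F) → Hₖ(U; F)` is onto, (S2) `j_* : Hₖ(P, P ∖ j⁻¹S; F) → Hₖ(U, U ∖ S; F)` is
one-to-one, and `Ψ` pulled back to `P ∖ j⁻¹S` vanishes, then `Ψ` vanishes on `U ∖ S`. (Pair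
`Ψ|_{U ∖ S}` with `b ∈ Hₖ(U ∖ S)`: the image of `b` in `Hₖ(U)` is `j_* a₀`, dies in
`Hₖ(U, U ∖ S)`, so `a₀` dies in `Hₖ(P, P ∖ j⁻¹S)` and comes from `Hₖ(P ∖ j⁻¹S)`, where `Ψ`
pairs to zero; conclude by universal coefficients over a field.)
[cite: HatcherAT2002, §2.1 (exact sequence of the pair) and §3.1 Thm. 3.2] -/
theorem map_subsetIncl_compl_eq_zero_of_surjective_of_injective {P U : Type u}
    [TopologicalSpace P] [TopologicalSpace U] (j : C(P, U)) (S : Set U) {k : ℕ}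
    (Ψ : singularCohomology F F U k)
    (hS1 : Function.Surjective (singularHomology.map F F j k))
    (hS2 : Function.Injective (relativeSingularHomology.map F F j
      (show MapsTo j (j ⁻¹' S)ᶜ Sᶜ from fun _ hx ↦ hx) k))
    (hΨ : singularCohomology.map F F (j.comp (subsetIncl (j ⁻¹' S)ᶜ)) k Ψ = 0) :
    singularCohomology.map F F (subsetIncl Sᶜ) k Ψ = 0 := by
  apply kroneckerPairing_injective_of_field F (↥Sᶜ) k
  rw [map_zero]
  refine LinearMap.ext fun b ↦ ?_
  rw [LinearMap.zero_apply, kroneckerPairing_map]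
  -- the image `β` of `b` in `Hₖ(U)` comes from the fibre
  obtain ⟨a₀, ha₀⟩ := hS1 (singularHomology.map F F (subsetIncl Sᶜ) k b)
  -- `β` dies in `Hₖ(U, U ∖ S)`
  have hq : relativeSingularHomology.ofAbsolute F F U Sᶜ k
      (singularHomology.map F F (subsetIncl Sᶜ) k b) = 0 := by
    rw [← ModuleCat.comp_apply, relativeSingularHomology.map_comp_ofAbsolute]
    rfl
  -- hence `a₀` dies in `Hₖ(P, P ∖ j⁻¹S)` (naturality and (S2))
  have h0 : relativeSingularHomology.map F F j (show MapsTo j (j ⁻¹' S)ᶜ Sᶜ from fun _ hx ↦ hx) k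
      (relativeSingularHomology.ofAbsolute F F P (j ⁻¹' S)ᶜ k a₀) = 0 := by
    rw [← ModuleCat.comp_apply, relativeSingularHomology.ofAbsolute_comp_map, ModuleCat.comp_apply,
      ha₀, hq]
  have hqa : relativeSingularHomology.ofAbsolute F F P (j ⁻¹' S)ᶜ k a₀ = 0 :=
    hS2 (by rw [h0, map_zero])
  -- so `a₀` comes from `Hₖ(P ∖ j⁻¹S)`, where `Ψ` pairs to zero
  obtain ⟨a₁, ha₁⟩ := ((ShortComplex.moduleCat_exact_iff _).1
    (relativeSingularHomology.exact_map_ofAbsolute F F (X := P) (j ⁻¹' S)ᶜ k)) a₀ hqa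
  rw [← ha₀, ← ha₁]
  change kroneckerPairing F F U k Ψ ((singularHomology.map F F (subsetIncl (j ⁻¹' S)ᶜ) k ≫
    singularHomology.map F F j k) a₁) = 0
  rw [← singularHomology.map_comp, ← kroneckerPairing_map, hΨ, map_zero, LinearMap.zero_apply]

/-! ### The form with a bad set `Z ⊆ V` inside the support -/

section Fibre

variable {E X₀ : Type u} [TopologicalSpace E] [TopologicalSpace X₀] (ι₀ : C(X₀, E))

/-! In what follows `subsetRestrict ι₀ (mapsTo_preimage ι₀ Zᶜ) : X₀ ∖ ι₀⁻¹Z → E ∖ Z` is the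
restriction of `ι₀ : X₀ → E` off the bad set `Z` (the map `j` of the propagation lemma). -/

/-- The restriction `X₀ ∖ ι₀⁻¹Z → E ∖ Z` of `ι₀` maps the complement of the support `ι₀⁻¹V` to
the complement of `V` (a map of pairs). [folklore] -/
theorem mapsTo_subsetRestrict_preimage_compl (Z V : Set E) :
    MapsTo (subsetRestrict ι₀ (mapsTo_preimage ι₀ Zᶜ))
      ((subsetRestrict ι₀ (mapsTo_preimage ι₀ Zᶜ)) ⁻¹' (Subtype.val ⁻¹' V))ᶜ
      (Subtype.val ⁻¹' V : Set ↥Zᶜ)ᶜ :=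
  fun _ hx ↦ hx

/-- **Propagation of the support from a fibre, with a bad set.** Let `ι₀ : X₀ → E`, `Z ⊆ V ⊆ E`,
`Ψ ∈ Hᵏ(E; F)` over a field. Put `U = E ∖ Z`, `P = X₀ ∖ ι₀⁻¹Z`, `j = ι₀| : P → U` and
`S = V ∖ Z ⊆ U`. If (S1) `j_* : Hₖ(P) → Hₖ(U)` is onto and (S2)
`j_* : Hₖ(P, P ∖ j⁻¹S) → Hₖ(U, U ∖ S)` is one-to-one, and `Ψ` dies on `X₀ ∖ ι₀⁻¹V`, then `Ψ`
dies on `E ∖ V`. [cite: HatcherAT2002, §2.1 (exact sequence of the pair) and §3.1 Thm. 3.2] -/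
theorem map_subsetIncl_compl_eq_zero_of_fibre {Z V : Set E} (hZV : Z ⊆ V) {k : ℕ}
    (Ψ : singularCohomology F F E k)
    (hS1 : Function.Surjective (singularHomology.map F F (subsetRestrict ι₀ (mapsTo_preimage ι₀ Zᶜ)) k))
    (hS2 : Function.Injective (relativeSingularHomology.map F F (subsetRestrict ι₀ (mapsTo_preimage ι₀ Zᶜ))
      (mapsTo_subsetRestrict_preimage_compl ι₀ Z V) k))
    (hΨ : singularCohomology.map F F (ι₀.comp (subsetIncl (ι₀ ⁻¹' V)ᶜ)) k Ψ = 0) :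
    singularCohomology.map F F (subsetIncl Vᶜ) k Ψ = 0 := by
  set j := subsetRestrict ι₀ (mapsTo_preimage ι₀ Zᶜ) with hj
  set S : Set ↥Zᶜ := Subtype.val ⁻¹' V with hS
  -- the lemma applied to `Ψ|_U`
  have hΨU : singularCohomology.map F F (j.comp (subsetIncl (j ⁻¹' S)ᶜ)) k
      (singularCohomology.map F F (subsetIncl Zᶜ) k Ψ) = 0 := by
    -- `U ← P ∖ j⁻¹S` factors through `X₀ ∖ ι₀⁻¹V → E`
    let g : C(↥(j ⁻¹' S)ᶜ, ↥(ι₀ ⁻¹' V)ᶜ) :=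
      ⟨fun x ↦ ⟨x.1.1, x.2⟩, by fun_prop⟩
    have hfac : (subsetIncl Zᶜ).comp (j.comp (subsetIncl (j ⁻¹' S)ᶜ)) =
        (ι₀.comp (subsetIncl (ι₀ ⁻¹' V)ᶜ)).comp g := rfl
    rw [← ModuleCat.comp_apply, ← singularCohomology.map_comp, hfac, singularCohomology.map_comp,
      ModuleCat.comp_apply, hΨ, map_zero]
  have hU := map_subsetIncl_compl_eq_zero_of_surjective_of_injective F j S
    (singularCohomology.map F F (subsetIncl Zᶜ) k Ψ) hS1 hS2 hΨU
  -- `E ∖ V → E` factors through `U ∖ S → U → E`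
  let g' : C(↥Vᶜ, ↥Sᶜ) :=
    ⟨fun x ↦ ⟨⟨x.1, fun h ↦ x.2 (hZV h)⟩, x.2⟩, by fun_prop⟩
  have hfac' : subsetIncl Vᶜ = ((subsetIncl Zᶜ).comp (subsetIncl Sᶜ)).comp g' := rfl
  rw [hfac', singularCohomology.map_comp, singularCohomology.map_comp, ModuleCat.comp_apply,
    ModuleCat.comp_apply, hU, map_zero]

/-! ### Sums of supports -/

/-- **Sums of supports propagate from a fibre.** Let `ι₀ : X₀ → E` induce a BIJECTION
`ι₀^* : Hᵏ(E; F) → Hᵏ(X₀; F)` (e.g. the inclusion of a fibre of a fibration over a ball), and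
let `Z i ⊆ V i ⊆ E` be subsets such that for every `i` the restriction
`j_i : X₀ ∖ ι₀⁻¹(Z i) → E ∖ Z i` of `ι₀` is onto on `Hₖ` and one-to-one on the local homology
`Hₖ(– , – ∖ V i)`. If `ι₀^* A` is a sum of classes of `Hᵏ(X₀)` dying on the `X₀ ∖ ι₀⁻¹(V i)`, then
`A` is a sum of classes of `Hᵏ(E)` dying on the `E ∖ V i`: lift each summand along the bijection
`ι₀^*` and propagate it (`map_subsetIncl_compl_eq_zero_of_fibre`).
[cite: HatcherAT2002, §2.1 (exact sequence of the pair) and §3.1 Thm. 3.2] -/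
theorem mem_iSup_ker_of_fibre {k : ℕ}
    (hι₀ : Function.Bijective (singularCohomology.map F F ι₀ k)) {I : Type w} (Z V : I → Set E)
    (hZV : ∀ i, Z i ⊆ V i)
    (hS1 : ∀ i, Function.Surjective (singularHomology.map F F (subsetRestrict ι₀ (mapsTo_preimage ι₀ (Z i)ᶜ)) k))
    (hS2 : ∀ i, Function.Injective (relativeSingularHomology.map F F (subsetRestrict ι₀ (mapsTo_preimage ι₀ (Z i)ᶜ))
      (mapsTo_subsetRestrict_preimage_compl ι₀ (Z i) (V i)) k))
    (A : singularCohomology F F E k)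
    (hA : singularCohomology.map F F ι₀ k A ∈
      ⨆ i, LinearMap.ker (singularCohomology.map F F (subsetIncl (ι₀ ⁻¹' V i)ᶜ) k).hom) :
    A ∈ ⨆ i, LinearMap.ker (singularCohomology.map F F (subsetIncl (V i)ᶜ) k).hom := by
  -- the property "has a lift along `ι₀^*` lying in the sum of the kernels" is additive
  suffices h : ∃ A' : singularCohomology F F E k,
      singularCohomology.map F F ι₀ k A' = singularCohomology.map F F ι₀ k A ∧
        A' ∈ ⨆ i, LinearMap.ker (singularCohomology.map F F (subsetIncl (V i)ᶜ) k).hom by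
    obtain ⟨A', hA'A, hA'⟩ := h
    rwa [← hι₀.1 hA'A]
  refine Submodule.iSup_induction (M := singularCohomology F F X₀ k)
    (fun i ↦ LinearMap.ker (singularCohomology.map F F (subsetIncl (ι₀ ⁻¹' V i)ᶜ) k).hom)
    (motive := fun a ↦ ∃ A' : singularCohomology F F E k,
      singularCohomology.map F F ι₀ k A' = a ∧
        A' ∈ ⨆ i, LinearMap.ker (singularCohomology.map F F (subsetIncl (V i)ᶜ) k).hom)
    hA (fun i a ha ↦ ?_) ⟨0, map_zero _, Submodule.zero_mem _⟩ ?_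
  · -- a summand dying on `X₀ ∖ ι₀⁻¹(V i)`: lift it and propagate
    obtain ⟨A', rfl⟩ := hι₀.2 a
    refine ⟨A', rfl, Submodule.mem_iSup_of_mem i (LinearMap.mem_ker.2 ?_)⟩
    refine map_subsetIncl_compl_eq_zero_of_fibre F ι₀ (hZV i) A' (hS1 i) (hS2 i) ?_
    rw [singularCohomology.map_comp, ModuleCat.comp_apply]
    exact LinearMap.mem_ker.1 ha
  · rintro a b ⟨A', rfl, hA'⟩ ⟨B', rfl, hB'⟩
    exact ⟨A' + B', map_add _ _ _, Submodule.add_mem _ hA' hB'⟩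

/-- **Sums of supports propagate from a fibre to every other fibre**: under the hypotheses of
`mem_iSup_ker_of_fibre`, for every continuous `g : T → E` the class `g^* A` is a sum of classes
of `Hᵏ(T; F)` dying on the `T ∖ g⁻¹(V i)` (naturality of restriction).
[cite: HatcherAT2002, §2.1 (exact sequence of the pair) and §3.1 Thm. 3.2] -/
theorem map_mem_iSup_ker_of_fibre {k : ℕ}
    (hι₀ : Function.Bijective (singularCohomology.map F F ι₀ k)) {I : Type w} (Z V : I → Set E)
    (hZV : ∀ i, Z i ⊆ V i)
    (hS1 : ∀ i, Function.Surjective (singularHomology.map F F (subsetRestrict ι₀ (mapsTo_preimage ι₀ (Z i)ᶜ)) k))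
    (hS2 : ∀ i, Function.Injective (relativeSingularHomology.map F F (subsetRestrict ι₀ (mapsTo_preimage ι₀ (Z i)ᶜ))
      (mapsTo_subsetRestrict_preimage_compl ι₀ (Z i) (V i)) k))
    (A : singularCohomology F F E k)
    (hA : singularCohomology.map F F ι₀ k A ∈
      ⨆ i, LinearMap.ker (singularCohomology.map F F (subsetIncl (ι₀ ⁻¹' V i)ᶜ) k).hom)
    {T : Type u} [TopologicalSpace T] (g : C(T, E)) :
    singularCohomology.map F F g k A ∈
      ⨆ i, LinearMap.ker (singularCohomology.map F F (subsetIncl (g ⁻¹' V i)ᶜ) k).hom := by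
  have hA' := mem_iSup_ker_of_fibre F ι₀ hι₀ Z V hZV hS1 hS2 A hA
  refine Submodule.iSup_induction (M := singularCohomology F F E k)
    (fun i ↦ LinearMap.ker (singularCohomology.map F F (subsetIncl (V i)ᶜ) k).hom)
    (motive := fun B ↦ singularCohomology.map F F g k B ∈
      ⨆ i, LinearMap.ker (singularCohomology.map F F (subsetIncl (g ⁻¹' V i)ᶜ) k).hom)
    hA' (fun i B hB ↦ ?_) (by rw [map_zero]; exact Submodule.zero_mem _) fun B B' hB hB' ↦ ?_
  · refine Submodule.mem_iSup_of_mem i (LinearMap.mem_ker.2 ?_)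
    -- `T ∖ g⁻¹(V i) → T → E` factors through `E ∖ V i → E`
    have hfac : g.comp (subsetIncl (g ⁻¹' V i)ᶜ) =
        (subsetIncl (V i)ᶜ).comp
          (subsetRestrict g (show MapsTo g (g ⁻¹' V i)ᶜ (V i)ᶜ from fun _ hx ↦ hx)) := rfl
    change (singularCohomology.map F F g k ≫ singularCohomology.map F F (subsetIncl (g ⁻¹' V i)ᶜ) k)
      B = 0
    rw [← singularCohomology.map_comp, hfac, singularCohomology.map_comp, ModuleCat.comp_apply,
      LinearMap.mem_ker.1 hB, map_zero]
  · rw [map_add]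
    exact Submodule.add_mem _ hB hB'

end Fibre

end Literature.AlgebraicTopology.SingularHomology

end
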